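import Literature.MathematicalPhysics.QuantumFieldTheory.Balaban1983to89.Node00.BackgroundFamilyOfRecord
import Literature.MathematicalPhysics.QuantumFieldTheory.Balaban1983to89.B12ContinuousTransportInvarianceOn
import Literature.MathematicalPhysics.QuantumFieldTheory.BalabanImbrieJaffe1984to88.BIJ88RT51Background42
import Summits.QuantumFields.YangMills.Theorems.BalabanUVNodesN21NormaliseWithDefs
import Summits.QuantumFields.YangMills.Theorems.BalabanUVNodesN21InteriorLocalBg

/-!
# N21 (NE7c), strategy s3 «alternative currency», file 34b (DEFINITIONS) — THE MEASURABLE NORMALISATION: a MEASURABLE near-class representative `repM`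
# (first far-small member of a dense sequence of `SU(N)^{bonds}`) and the interior-local measurably-normalised family of record `𝔟ᴺᴹ`, at which
# (H-U) `Measurable (U_{k,□}(·))` is a THEOREM

HEADER — WORK-UNIT METADATA.  Seat `pub-ymgap-dag-n21-e` (R141 (C) fan-out, node N21 = NE7c `T4IndicatorShell.ShellWeightBound`, strategy s3), g11,
file 34b (g10 HANDOFF trigger t32 «a measurable near-saturated selector `𝔟ᴺᴹ`», taken by own hand; sequel of 34a `…N21NormaliseWithDefs`).  Lane:
`--kind definition --supports stmt-QuantumFields-20509 --as helper` (K3⁶ `SpineGivenEndpointR13SepCoPR`).  Count-neutral.  The objects are offered to NODE 00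
(def-R ∕ K0c) for adoption; until re-homed they live here under this seat's namespace.

THE CONTENT.
§2′ THE MEASURABLE REPRESENTATIVE `repM` (configurations over `SU(N)`, class `{U | PlaqSmall δ U}`, any averaging, any torus `P`): the fillers `q` making the far
   all-`Γ₀` plaquettes of the padded datum `δ`-small (34a `FarSmall`) form an OPEN set (`isOpen_setOf_farSmall_right`: finitely many strict inequalities of
   continuous functions, tree `continuous_dist1_SU` ∕ `continuous_plaqHol_SU`), NON-EMPTY for a solvable datum (34a `farSmall_self_of_isMinimizer`); a FIXED
   dense sequence of the compact metrisable `SU(N)^{bonds}` (`denseSeqCfg`, Mathlib `TopologicalSpace.exists_dense_seq` over K0c's instance preamble) meets it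
   (`exists_farSmall_denseSeqCfg`), and the LEAST such index `farIdx` — read through the near scale-`0` part only, hence class-determined — is MEASURABLE
   (`measurable_farIdx₀` ∕ `measurable_farIdx`: the level sets are finite Boolean combinations of the open events, `measurable_to_countable'`, `Nat.find_eq_iff`).
   `repM δ 𝔹 X := padNear 𝔹 X (denseSeqCfg (farIdx …))`: class-determined (`repM_eq_of_agreeOn`), agrees with `X` on `near 𝔹` (`agreeOn_near_repM`), MEASURABLE
   (`measurable_repM`), and — ★ `isMinimizer_spliceCfg_repM` — SOLVABLE whenever `X` is: the splice of a minimiser `W` for `X` is a minimiser for `repM X` by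
   file 27 (R1) `isMinimizer_spliceCfg_of_datumGood` (near all-`Γ₀` plaquettes = `W`'s, far ones `δ`-small by `farIdx`).  Whence `repM_spec : RepSpec bg (repM δ)`
   for every datum over `SU(N)` with class `{PlaqSmall δ}` whose domain is the solvable set (def-R's `bgOfRecord`: `Iff.rfl`).
§3 AT THE RECORD: `bgNormMFamOfRecord ν : BgFam F N := fun K k => normaliseWith (bgFamOfRecord F N ν K k) _ (repM (ν.εreg·η_k²)) (repM_spec _ _)` — SAME class,
   SAME solvable domain as the family of record (`rfl`), the datum on the `Γ₀`-bonds (`bgNormMFam_U_ext`), ★ INTERIOR-LOCAL (`bgNormMFam_local`; file 35's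
   clause (H-L) `interiorLocalBg_bgNormMFam`; `ukBox_bgNormMFam_congr_on` — the (2.16) support-level dependence), and ★★ `localBgMeasurableBg_bgNormMFam : LocalBgMeasurableBg F N ν (bgNormMFamOfRecord F N ν)`
   — (H-U) HYPOTHESIS-FREE AT AN INTERIOR-LOCAL FAMILY (K0c `measurable_UminOfRecord` for the datum of record + `measurable_repM` + 34a
   `measurable_normaliseWith_U`; the averaging and `Q_k^{s*}` measurable by `measurable_iter` ∕ `measurable_qsstarGIter0`).  Sequels (files 35 ∕ 36):
   22c ∕ 28 ∕ 29 ∕ 31 §5 ∕ 32 for ANY interior-local family, instantiated at `𝔟ᴺᴹ` with (LOC), (DISJ) AND (H-U) all theorems.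

HONEST FRAMING.  DEFINITIONS + [folklore] measure theory over 34a, r11, K0c (`Record12MinimiserSelection`, `Record12MeasurabilityAbsolute`), def-R (FILE 1 ∕ FILE 19)
and this lineage's file 27.  Nothing of Bałaban's is asserted ([15] Thm 1 — existence ∕ uniqueness of the minimiser — is NOT used); no record is restated or
re-pointed (the family of record stays `bgFamOfRecord`; `bgNormMFamOfRecord` is an OFFERED twin); NE7c NOT PRINTED ∕ NOT proved; N21 NOT discharged; counts
UNMOVED (typed 28∕28 · discharged 5∕27); count-neutral; one finite 𝕋⁴ at fixed `ε = L^{−K}` — NOT ℝ⁴ ∕ OS ∕ mass gap ∕ Clay.  No `sorry`, no `axiom`, no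
`instance`, no `notation`.

CITATION HEADER (lean-in-tree rule 2026-08-18).  BY NAME: 34a `normaliseWith` ∕ `RepSpec` ∕ `RepLocal` ∕ `normaliseWith_U_ext` ∕ `normaliseWith_local` ∕
`ukBox_normaliseWith_congr_on` ∕ `measurable_normaliseWith_U` ∕ `pad0` ∕ `pad0_of_mem` ∕ `pad0_of_not_mem` ∕ `pad0_congr` ∕ `padNear` ∕ `padNear_succ` ∕ `agreeOn_near_padNear` ∕
`padNear_eq_of_agreeOn` ∕ `farPlaqs` ∕ `FarSmall` ∕ `plaqHol_pad0_of_near` ∕ `farSmall_pad0_iff` ∕ `farSmall_self_of_isMinimizer`; r11 `B14.Eq12InteriorLocality.spliceCfg` ∕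
`near` ∕ `nearSites` ∕ `farBonds` ∕ `extBonds` ∕ `plaqBonds` ∕ `plaqDetermined_plaqSmall`; r11 `B14.Eq216Concrete.ukBox` ∕ `liftIter` ∕ `inputs`; r12 `B15DeterminingSets.DetBackground`
∕ `IsMinimizer` ∕ `AgreeOn` ∕ `avgFamily` ∕ `bondsOf`; def-R `Node00.BgFam` ∕ `bgFamOfRecord` ∕ `bgFamOfRecord_U` ∕ `LocalBgMeasurableBg` ∕ `UminOfRecord` ∕ `avOfRecord` ∕
`Stage7Numerics`; K0c `Node00.measurable_UminOfRecord`; `T4Continuum.measurable_iter` ∕ `Node00.avOfRecord_measurable`; `BIJ88RT51Background42.measurable_qsstarGIter0`;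
`B12ContinuousTransportInvarianceOn.continuous_dist1_SU` ∕ `continuous_plaqHol_SU`; `secondCountableTopology_matrix`; `QuantumLattice.fundamentalRep` ∕
`continuous_fundamentalRep` ∕ `fundamentalRep_injective`; file 27 `isMinimizer_spliceCfg_of_datumGood`; Mathlib `TopologicalSpace.exists_dense_seq` ∕
`DenseRange.exists_mem_open` ∕ `measurable_to_countable'` ∕ `Nat.find_eq_iff`.  Context only (SHAPE, nothing asserted): [Balaban1988Convergent] (2.2) p. 255,
(2.10)–(2.13) p. 256, (2.16)–(2.17) p. 257.
-/

set_option autoImplicit false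

noncomputable section

open MeasureTheory Set TopologicalSpace

namespace Summit.QuantumFields.YangMills.Theorems.N21NormaliseMeasurableDefs

open Literature.MathematicalPhysics.QuantumFieldTheory.Balaban1983to89
open Literature.MathematicalPhysics.QuantumFieldTheory.Balaban1983to89.Node00
open T4Continuum B15DeterminingSets B14.Eq213DetSet B14.Eq216Concrete B14.Eq12InteriorLocality
open Literature.MathematicalPhysics.QuantumFieldTheory.BalabanImbrieJaffe1984to88.BIJ85Eq453GaugeField (qsstarGIter0)
open Literature.MathematicalPhysics.QuantumFieldTheory.BalabanImbrieJaffe1984to88.BIJ88RT51Background42 (measurable_qsstarGIter0)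
open Literature.MathematicalPhysics.QuantumLattice (fundamentalRep continuous_fundamentalRep fundamentalRep_injective)
open B12ContinuousTransportInvarianceOn (continuous_dist1_SU continuous_plaqHol_SU)
open Summit.QuantumFields.YangMills.Theorems.N21ThresholdMixtureRStepLocalityRaw (plaqHol_eq_datum_of_isMinimizer)
open Summit.QuantumFields.YangMills.Theorems.N21ThresholdMixtureRStepLocalityRawRepaired (isMinimizer_spliceCfg_of_datumGood)
open Summit.QuantumFields.YangMills.Theorems.N21NormaliseWithDefs
open Summit.QuantumFields.YangMills.Theorems.N21InteriorLocalBg (InteriorLocalBg)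

/-! ## §2′  The measurable near-class representative `repM` -/
section RepM

variable (P : Params) (N : ℕ) [NeZero N]

omit [NeZero N] in
/-- The configuration space `SU(N)^{bonds}` at scale `0` is second countable (K0c's instance preamble: `SU(N)` is a closed subspace of the `N × N` complex
matrices). [folklore] -/
theorem secondCountableTopology_cfg : SecondCountableTopology (GaugeField P 0 (SU N)) := by
  have hemb : Topology.IsClosedEmbedding (fundamentalRep (Fin N)) :=
    (continuous_fundamentalRep (Fin N)).isClosedEmbedding (fundamentalRep_injective (Fin N))
  haveI : SecondCountableTopology (SU N) := by
    haveI := secondCountableTopology_matrix (n := Fin N)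
    exact hemb.isEmbedding.secondCountableTopology
  exact inferInstanceAs (SecondCountableTopology (PBond P 0 → SU N))

omit [NeZero N] in
/-- … hence Borel = product σ-algebra on it. [folklore] -/
theorem borelSpace_cfg : BorelSpace (GaugeField P 0 (SU N)) := by
  have hemb : Topology.IsClosedEmbedding (fundamentalRep (Fin N)) :=
    (continuous_fundamentalRep (Fin N)).isClosedEmbedding (fundamentalRep_injective (Fin N))
  haveI : SecondCountableTopology (SU N) := by
    haveI := secondCountableTopology_matrix (n := Fin N)
    exact hemb.isEmbedding.secondCountableTopology
  exact inferInstanceAs (BorelSpace (PBond P 0 → SU N))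

/-- A DENSE SEQUENCE of scale-`0` configurations exists (separable, non-empty). [folklore] -/
theorem exists_denseSeq_cfg : ∃ u : ℕ → GaugeField P 0 (SU N), DenseRange u := by
  haveI := secondCountableTopology_cfg P N
  exact exists_dense_seq (GaugeField P 0 (SU N))

/-- A FIXED dense sequence of scale-`0` configurations. [folklore] -/
def denseSeqCfg : ℕ → GaugeField P 0 (SU N) := Classical.choose (exists_denseSeq_cfg P N)

/-- The fixed sequence is dense. [folklore] -/
theorem denseRange_denseSeqCfg : DenseRange (denseSeqCfg P N) := Classical.choose_spec (exists_denseSeq_cfg P N)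

variable {P N}

omit [NeZero N] in
/-- `pad0` is continuous in the filler. [folklore] -/
theorem continuous_pad0_right (𝔹 : DetSet P) (z : GaugeField P 0 (SU N)) : Continuous fun q : GaugeField P 0 (SU N) => pad0 𝔹 z q := by
  refine continuous_pi fun b => ?_
  by_cases hb : b ∈ bondsOf (nearSites 𝔹)
  · simp only [pad0_of_mem 𝔹 z _ hb]
    exact continuous_const
  · simp only [pad0_of_not_mem 𝔹 z _ hb]
    exact continuous_apply b

omit [NeZero N] in
/-- `pad0` is continuous in the padded configuration. [folklore] -/
theorem continuous_pad0_left (𝔹 : DetSet P) (q : GaugeField P 0 (SU N)) : Continuous fun z : GaugeField P 0 (SU N) => pad0 𝔹 z q := by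
  refine continuous_pi fun b => ?_
  by_cases hb : b ∈ bondsOf (nearSites 𝔹)
  · simp only [pad0_of_mem 𝔹 _ q hb]
    exact continuous_apply b
  · simp only [pad0_of_not_mem 𝔹 _ q hb]
    exact continuous_const

/-- The fillers making the far all-`Γ₀` plaquettes `δ`-small form an OPEN set (finitely many strict inequalities of continuous functions). [folklore] -/
theorem isOpen_setOf_farSmall_right (δ : ℝ) (𝔹 : DetSet P) (z : GaugeField P 0 (SU N)) : IsOpen {q : GaugeField P 0 (SU N) | FarSmall δ 𝔹 z q} := by
  have h : {q : GaugeField P 0 (SU N) | FarSmall δ 𝔹 z q} =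
      ⋂ p ∈ farPlaqs 𝔹, {q | GaugeGroup.dist1 (GaugeField.plaqHol (pad0 𝔹 z q) p) < δ} := by
    ext q
    simp only [FarSmall, mem_setOf_eq, mem_iInter]
  rw [h]
  exact (Set.toFinite _).isOpen_biInter fun p _ =>
    isOpen_lt (continuous_dist1_SU.comp ((continuous_plaqHol_SU p).comp (continuous_pad0_right 𝔹 z))) continuous_const

/-- … and so do the padded configurations, for a fixed filler. [folklore] -/
theorem isOpen_setOf_farSmall_left (δ : ℝ) (𝔹 : DetSet P) (q : GaugeField P 0 (SU N)) : IsOpen {z : GaugeField P 0 (SU N) | FarSmall δ 𝔹 z q} := by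
  have h : {z : GaugeField P 0 (SU N) | FarSmall δ 𝔹 z q} =
      ⋂ p ∈ farPlaqs 𝔹, {z | GaugeGroup.dist1 (GaugeField.plaqHol (pad0 𝔹 z q) p) < δ} := by
    ext z
    simp only [FarSmall, mem_setOf_eq, mem_iInter]
  rw [h]
  exact (Set.toFinite _).isOpen_biInter fun p _ =>
    isOpen_lt (continuous_dist1_SU.comp ((continuous_plaqHol_SU p).comp (continuous_pad0_left 𝔹 q))) continuous_const

/-- For a SOLVABLE datum some member of the dense sequence is a far-small filler (the set is open and contains `X₀`). [cite: Balaban1988Convergent, (2.12) p.256] -/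
theorem exists_farSmall_denseSeqCfg {av : ∀ j, Averaging P j (SU N)} {δ : ℝ} {𝔹 : DetSet P} {X : MSField P (SU N)} {W : GaugeField P 0 (SU N)}
    (hW : IsMinimizer av {U | PlaqSmall δ U} 𝔹 X W) : ∃ n, FarSmall δ 𝔹 (X 0) (denseSeqCfg P N n) :=
  (denseRange_denseSeqCfg P N).exists_mem_open (isOpen_setOf_farSmall_right δ 𝔹 (X 0)) ⟨X 0, farSmall_self_of_isMinimizer hW⟩

variable (P N)

open Classical in
/-- THE LEAST FAR-SMALL INDEX of a scale-`0` configuration (junk `0` if none). [folklore] -/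
def farIdx₀ (δ : ℝ) (𝔹 : DetSet P) (z : GaugeField P 0 (SU N)) : ℕ :=
  if h : ∃ n, FarSmall δ 𝔹 z (denseSeqCfg P N n) then Nat.find h else 0

/-- THE LEAST FAR-SMALL INDEX OF A DATUM, read through its near scale-`0` part only (class-determined by construction). [folklore] -/
def farIdx (δ : ℝ) (𝔹 : DetSet P) (X : MSField P (SU N)) : ℕ :=
  farIdx₀ P N δ 𝔹 (pad0 𝔹 (X 0) 1)

/-- **THE MEASURABLE NEAR-CLASS REPRESENTATIVE**: the datum padded, at scale `0`, with the first far-small member of the dense sequence.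
[cite: Balaban1988Convergent, (2.10)–(2.12) p.256] -/
def repM (δ : ℝ) (𝔹 : DetSet P) (X : MSField P (SU N)) : MSField P (SU N) :=
  padNear 𝔹 X (denseSeqCfg P N (farIdx P N δ 𝔹 X))

variable {P N}

open Classical in
/-- When a far-small filler exists in the sequence, `farIdx₀` points at one. [folklore] -/
theorem farSmall_farIdx₀ {δ : ℝ} {𝔹 : DetSet P} {z : GaugeField P 0 (SU N)} (h : ∃ n, FarSmall δ 𝔹 z (denseSeqCfg P N n)) :
    FarSmall δ 𝔹 z (denseSeqCfg P N (farIdx₀ P N δ 𝔹 z)) := by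
  unfold farIdx₀
  rw [dif_pos h]
  exact Nat.find_spec h

/-- … hence so does `farIdx`. [folklore] -/
theorem farSmall_farIdx {δ : ℝ} {𝔹 : DetSet P} {X : MSField P (SU N)} (h : ∃ n, FarSmall δ 𝔹 (X 0) (denseSeqCfg P N n)) :
    FarSmall δ 𝔹 (X 0) (denseSeqCfg P N (farIdx P N δ 𝔹 X)) := by
  have h' : ∃ n, FarSmall δ 𝔹 (pad0 𝔹 (X 0) 1) (denseSeqCfg P N n) := by
    obtain ⟨n, hn⟩ := h
    exact ⟨n, (farSmall_pad0_iff δ 𝔹 (X 0) _ 1).2 hn⟩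
  exact (farSmall_pad0_iff δ 𝔹 (X 0) _ 1).1 (farSmall_farIdx₀ h')

/-- `farIdx` is class-determined. [cite: Balaban1988Convergent, (2.10) p.256 (bookkeeping)] -/
theorem farIdx_eq_of_agreeOn (δ : ℝ) (𝔹 : DetSet P) {X X' : MSField P (SU N)} (h : AgreeOn (near 𝔹) X X') :
    farIdx P N δ 𝔹 X = farIdx P N δ 𝔹 X' := by
  unfold farIdx
  rw [pad0_congr 𝔹 (fun b hb => h 0 b hb) 1]

/-- `repM` is CLASS-DETERMINED (`RepLocal`). [cite: Balaban1988Convergent, (2.10) p.256] -/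
theorem repM_eq_of_agreeOn (δ : ℝ) : RepLocal (repM P N δ) := by
  intro 𝔹 X X' h
  unfold repM
  rw [farIdx_eq_of_agreeOn δ 𝔹 h, padNear_eq_of_agreeOn 𝔹 h]

/-- `repM X` agrees with `X` on `near 𝔹`. [cite: Balaban1988Convergent, (2.10) p.256] -/
theorem agreeOn_near_repM (δ : ℝ) (𝔹 : DetSet P) (X : MSField P (SU N)) : AgreeOn (near 𝔹) X (repM P N δ 𝔹 X) :=
  agreeOn_near_padNear 𝔹 X _

/-- ★ **A SOLVABLE DATUM HAS A SOLVABLE REPRESENTATIVE**: for a determining set of the standing range and a minimiser `W` of (2.12) for `X` in the class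
`{PlaqSmall δ}`, the splice `((repM X)₀ ∣ W)` is a minimiser for `repM X` — file 27 (R1) with the near all-`Γ₀` plaquettes of the padded datum equal to
`W`'s and the far ones `δ`-small by the choice of `farIdx`. [cite: Balaban1988Convergent, (2.12) p.256] -/
theorem isMinimizer_spliceCfg_repM {av : ∀ j, Averaging P j (SU N)} {δ : ℝ} {𝔹 : DetSet P} (h𝔹 : ∀ j, P.m + P.K < j → 𝔹 j = ∅)
    {X : MSField P (SU N)} {W : GaugeField P 0 (SU N)} (hW : IsMinimizer av {U | PlaqSmall δ U} 𝔹 X W) :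
    IsMinimizer av {U | PlaqSmall δ U} 𝔹 (repM P N δ 𝔹 X) (spliceCfg 𝔹 (repM P N δ 𝔹 X) W) := by
  refine isMinimizer_spliceCfg_of_datumGood (reg := {U | PlaqSmall δ U}) (good := fun _ => {g | GaugeGroup.dist1 g < δ})
    (fun _ => Iff.rfl) h𝔹 (fun j b hb => (agreeOn_near_repM δ 𝔹 X j b hb).symm) (fun p hp => ?_) hW
  show GaugeGroup.dist1 (GaugeField.plaqHol (pad0 𝔹 (X 0) (denseSeqCfg P N (farIdx P N δ 𝔹 X))) p) < δ
  by_cases hnear : plaqBonds p ⊆ bondsOf (nearSites 𝔹)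
  · rw [plaqHol_pad0_of_near 𝔹 _ _ hnear, ← plaqHol_eq_datum_of_isMinimizer hW hp]
    exact hW.1 p
  · exact farSmall_farIdx (exists_farSmall_denseSeqCfg hW) p ⟨hp, hnear⟩

/-- `repM` MEETS THE SPEC for every datum over `SU(N)` with class `{PlaqSmall δ}` whose domain is the solvable set (def-R's `bgOfRecord`: `Iff.rfl`).
[cite: Balaban1988Convergent, (2.12) p.256] -/
theorem repM_spec {av : ∀ j, Averaging P j (SU N)} {δ : ℝ} (bg : DetBackground P (SU N) av)
    (hdom : ∀ (𝔹 : DetSet P) (X : MSField P (SU N)), X ∈ bg.dom 𝔹 ↔ ∃ U₀, IsMinimizer av {U | PlaqSmall δ U} 𝔹 X U₀) :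
    RepSpec bg (repM P N δ) := by
  intro 𝔹 h𝔹 X hX
  obtain ⟨W, hW⟩ := (hdom 𝔹 X).1 hX
  exact ⟨agreeOn_near_repM δ 𝔹 X, (hdom 𝔹 _).2 ⟨_, isMinimizer_spliceCfg_repM h𝔹 hW⟩⟩

open Classical in
/-- The level sets of `farIdx₀` are finite Boolean combinations of the OPEN far-smallness events, hence measurable. [folklore] -/
theorem measurableSet_farIdx₀_eq (δ : ℝ) (𝔹 : DetSet P) (m : ℕ) : MeasurableSet {z : GaugeField P 0 (SU N) | farIdx₀ P N δ 𝔹 z = m} := by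
  haveI := borelSpace_cfg P N
  have hA : ∀ n, MeasurableSet {z : GaugeField P 0 (SU N) | FarSmall δ 𝔹 z (denseSeqCfg P N n)} := fun n =>
    (isOpen_setOf_farSmall_left δ 𝔹 (denseSeqCfg P N n)).measurableSet
  have heq : {z : GaugeField P 0 (SU N) | farIdx₀ P N δ 𝔹 z = m} =
      ({z | FarSmall δ 𝔹 z (denseSeqCfg P N m)} ∩ ⋂ k, ⋂ (_ : k < m), {z | FarSmall δ 𝔹 z (denseSeqCfg P N k)}ᶜ) ∪
        ((⋃ n, {z : GaugeField P 0 (SU N) | FarSmall δ 𝔹 z (denseSeqCfg P N n)})ᶜ ∩ {_z | m = 0}) := by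
    ext z
    simp only [mem_setOf_eq, mem_union, mem_inter_iff, mem_iInter, mem_compl_iff, mem_iUnion, not_exists]
    unfold farIdx₀
    by_cases h : ∃ n, FarSmall δ 𝔹 z (denseSeqCfg P N n)
    · rw [dif_pos h, Nat.find_eq_iff]
      constructor
      · rintro ⟨hm, hlt⟩
        exact Or.inl ⟨hm, fun k hk => hlt k hk⟩
      · rintro (⟨hm, hlt⟩ | ⟨hnone, -⟩)
        · exact ⟨hm, fun k hk => hlt k hk⟩
        · obtain ⟨n, hn⟩ := h
          exact absurd hn (hnone n)
    · rw [dif_neg h]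
      constructor
      · intro hm
        exact Or.inr ⟨not_exists.1 h, hm.symm⟩
      · rintro (⟨hm, -⟩ | ⟨-, hm⟩)
        · exact absurd ⟨m, hm⟩ h
        · exact hm.symm
  rw [heq]
  refine MeasurableSet.union ((hA m).inter (MeasurableSet.iInter fun k => MeasurableSet.iInter fun _ => (hA k).compl))
    ((MeasurableSet.iUnion hA).compl.inter ?_)
  by_cases hm : m = 0
  · simp only [hm, setOf_true, MeasurableSet.univ]
  · simp only [hm, setOf_false, MeasurableSet.empty]

/-- `farIdx₀` is measurable. [folklore] -/
theorem measurable_farIdx₀ (δ : ℝ) (𝔹 : DetSet P) : Measurable (farIdx₀ P N δ 𝔹) :=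
  measurable_to_countable' fun m => measurableSet_farIdx₀_eq δ 𝔹 m

/-- The near scale-`0` projection `X ↦ pad0 𝔹 X₀ 1` is measurable. [folklore] -/
theorem measurable_pad0_one (𝔹 : DetSet P) : Measurable fun X : MSField P (SU N) => pad0 𝔹 (X 0) (1 : GaugeField P 0 (SU N)) := by
  refine measurable_pi_lambda _ fun b => ?_
  by_cases hb : b ∈ bondsOf (nearSites 𝔹)
  · simp only [pad0_of_mem 𝔹 _ _ hb]
    exact (measurable_pi_apply b).comp (measurable_pi_apply 0)
  · simp only [pad0_of_not_mem 𝔹 _ _ hb]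
    exact measurable_const

/-- ★ `farIdx` is a measurable function of the datum. [folklore] -/
theorem measurable_farIdx (δ : ℝ) (𝔹 : DetSet P) : Measurable (farIdx P N δ 𝔹) :=
  (measurable_farIdx₀ δ 𝔹).comp (measurable_pad0_one 𝔹)

/-- ★ **`repM` IS MEASURABLE** (bond by bond: a coordinate of `X`, the constant `1`, or a coordinate of the dense sequence read at the measurable index `farIdx`).
[folklore] -/
theorem measurable_repM (δ : ℝ) (𝔹 : DetSet P) : Measurable (repM P N δ 𝔹) := by
  refine measurable_pi_lambda _ fun j => ?_
  cases j with
  | zero =>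
    show Measurable fun X : MSField P (SU N) => pad0 𝔹 (X 0) (denseSeqCfg P N (farIdx P N δ 𝔹 X))
    refine measurable_pi_lambda _ fun b => ?_
    by_cases hb : b ∈ bondsOf (nearSites 𝔹)
    · simp only [pad0_of_mem 𝔹 _ _ hb]
      exact (measurable_pi_apply b).comp (measurable_pi_apply 0)
    · simp only [pad0_of_not_mem 𝔹 _ _ hb]
      exact (measurable_from_nat (f := fun n => denseSeqCfg P N n b)).comp (measurable_farIdx δ 𝔹)
  | succ j =>
    show Measurable fun X : MSField P (SU N) => padNear 𝔹 X (denseSeqCfg P N (farIdx P N δ 𝔹 X)) (j + 1)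
    simp only [padNear_succ]
    refine measurable_pi_lambda _ fun b => ?_
    by_cases hb : b ∈ bondsOf (𝔹 (j + 1))
    · simp only [if_pos hb]
      exact (measurable_pi_apply b).comp (measurable_pi_apply (j + 1))
    · simp only [if_neg hb]
      exact measurable_const

end RepM

/-! ## §3  At the record: the interior-local MEASURABLE normalisation of the family of record, (H-U) hypothesis-free -/

section AtRecord

variable (F : T4Family) (N : ℕ) [NeZero N]

/-- **THE MEASURABLY NORMALISED FAMILY OF RECORD** `𝔟ᴺᴹ`: at every torus `K` and level `k`, `normaliseWith` of def-R's datum of record over the class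
`|U(∂p) − 1| < εreg·η_k²` with the measurable representative `repM`.  Same class, same solvable domain, a (2.12) solution map of the same spec.
[cite: Balaban1988Convergent, (2.12) p.256, (2.16) p.257] -/
def bgNormMFamOfRecord (ν : Stage7Numerics) : BgFam F N := fun K k =>
  normaliseWith (bgFamOfRecord F N ν K k) (plaqDetermined_plaqSmall _) (repM (F.P K) N (ν.εreg * (F.P K).eta k ^ 2))
    (repM_spec (bgFamOfRecord F N ν K k) fun _ _ => Iff.rfl)

/-- Same regularity class as the family of record. [cite: Balaban1988Convergent, (2.12) p.256 (bookkeeping)] -/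
theorem bgNormMFamOfRecord_reg (ν : Stage7Numerics) (K k : ℕ) : (bgNormMFamOfRecord F N ν K k).reg = (bgFamOfRecord F N ν K k).reg := rfl

/-- Same solvable domain as the family of record. [cite: Balaban1988Convergent, (2.12) p.256 (bookkeeping)] -/
theorem bgNormMFamOfRecord_dom (ν : Stage7Numerics) (K k : ℕ) : (bgNormMFamOfRecord F N ν K k).dom = (bgFamOfRecord F N ν K k).dom := rfl

/-- On the `Γ₀`-bonds of a determining set of the standing range `𝔟ᴺᴹ` IS the datum. [cite: Balaban1988Convergent, (2.11)–(2.12) p.256] -/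
theorem bgNormMFam_U_ext (ν : Stage7Numerics) (K k : ℕ) {𝔹 : DetSet (F.P K)} (h𝔹 : ∀ j, (F.P K).m + (F.P K).K < j → 𝔹 j = ∅)
    (X : MSField (F.P K) (SU N)) {b : PBond (F.P K) 0} (hb : b ∈ extBonds 𝔹) : (bgNormMFamOfRecord F N ν K k).U 𝔹 X b = X 0 b :=
  normaliseWith_U_ext _ _ _ _ h𝔹 X hb

/-- ★ **`𝔟ᴺᴹ` IS INTERIOR-LOCAL**: data agreeing on `near 𝔹` give the same configuration off the far `Γ₀`-bonds. [cite: Balaban1988Convergent, (1.2) p.246, (2.12) p.256] -/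
theorem bgNormMFam_local (ν : Stage7Numerics) (K k : ℕ) {𝔹 : DetSet (F.P K)} (h𝔹 : ∀ j, (F.P K).m + (F.P K).K < j → 𝔹 j = ∅)
    {X X' : MSField (F.P K) (SU N)} (h : AgreeOn (near 𝔹) X X') :
    ∀ b, b ∉ farBonds 𝔹 → (bgNormMFamOfRecord F N ν K k).U 𝔹 X b = (bgNormMFamOfRecord F N ν K k).U 𝔹 X' b :=
  normaliseWith_local _ _ _ _ (repM_eq_of_agreeOn _) h𝔹 h

/-- ★ **(H-L) AT `𝔟ᴺᴹ`**: the measurably normalised family of record carries file 35's interior-locality clause `InteriorLocalBg` (so every theorem of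
files 35 ∕ 36 applies to it). [cite: Balaban1988Convergent, (1.2) p.246, (2.12) p.256] -/
theorem interiorLocalBg_bgNormMFam (ν : Stage7Numerics) : InteriorLocalBg F N ν (bgNormMFamOfRecord F N ν) :=
  fun K k _ hk _ _ hX b hb => bgNormMFam_local F N ν K k (Bj_standingRange ν.M₁ _ hk) hX b hb

/-- ★ **(2.16) AT SUPPORT LEVEL FOR `𝔟ᴺᴹ`**: `U_{k,□}(V_k) = U_{k,□}(W_k)` off the far `Γ₀`-bonds of `𝐁_k(□^{∼4})` whenever `V_k = W_k` on
`liftIter k (inputs (near 𝐁_k(□^{∼4})))` (`k ≤ m + K`). [cite: Balaban1988Convergent, (2.16) p.257] -/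
theorem ukBox_bgNormMFam_congr_on (ν : Stage7Numerics) (K k : ℕ) (M₁ : ℕ) {box4 : Set (Site (F.P K) 0)} (hk : k ≤ (F.P K).m + (F.P K).K)
    {Vk Wk : GaugeField (F.P K) k (SU N)} (h : ∀ c ∈ liftIter k (inputs (near (Bj M₁ box4 k))), Vk c = Wk c) :
    ∀ b₀ ∈ (farBonds (Bj M₁ box4 k))ᶜ,
      ukBox (bgNormMFamOfRecord F N ν K k) M₁ box4 k Vk b₀ = ukBox (bgNormMFamOfRecord F N ν K k) M₁ box4 k Wk b₀ :=
  ukBox_normaliseWith_congr_on _ _ _ _ (repM_eq_of_agreeOn _) M₁ hk h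

/-- ★★ **(H-U) AT `𝔟ᴺᴹ`, HYPOTHESIS-FREE**: every (2.16) local background `V_k ↦ U_{k,□}(V_k)` over the measurably normalised family of record is a
measurable map of the field — def-R's clause `LocalBgMeasurableBg F N ν` AT AN INTERIOR-LOCAL FAMILY (K0c `measurable_UminOfRecord` for the datum of
record, `measurable_repM`, `measurable_normaliseWith_U`, the averaging and `Q_k^{s*}` measurable). [cite: Balaban1988Convergent, (2.12) p.256, (2.16) p.257] -/
theorem localBgMeasurableBg_bgNormMFam (ν : Stage7Numerics) : LocalBgMeasurableBg F N ν (bgNormMFamOfRecord F N ν) := by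
  intro K k box4
  have hM : Measurable (avgFamily (avOfRecord F N K) : GaugeField (F.P K) 0 (SU N) → MSField (F.P K) (SU N)) :=
    measurable_pi_lambda _ fun j => measurable_iter (avOfRecord F N K) (avOfRecord_measurable F N K) j
  have hU : Measurable ((bgFamOfRecord F N ν K k).U (Bj ν.M₁ box4 k)) := by
    rw [bgFamOfRecord_U]
    exact measurable_UminOfRecord F N K k _ ν.M₁ box4
  exact (measurable_normaliseWith_U _ _ _ _ (Bj ν.M₁ box4 k) hU (measurable_repM _ _)).comp (hM.comp (measurable_qsstarGIter0 k))

end AtRecord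

end Summit.QuantumFields.YangMills.Theorems.N21NormaliseMeasurableDefs

end
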